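import Summits.ValiantsHypothesis.ValiantsHypothesis.Theses.FeketeSOS
import Literature.Computability.AlgebraicComplexity.SetMultilinear
import Literature.Computability.AlgebraicComplexity.SOSDecompositionProofs
import Literature.Computability.AlgebraicComplexity.ValiantClasses
import Literature.Computability.AlgebraicComplexity.ValiantCriterion
import Literature.Computability.AlgebraicComplexity.BurgisserBooleanPartsModPCircuits
import Literature.Computability.Cryptography.ModExpCircuits

/-!
# Line `sml-polarised-transport` — crux `FeketeSOS.SOSMagnification` (stmt-ValiantsHypothesis-3995)

LEAD SKELETON (prover-line-stmt-ValiantsHypothesis-3995-0, 2026-08-16), reshaped from the planner's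
`Lines/sml-polarised-transport.lean` (planner-cruxplan-…-sml-polarised-transp-0):

* the T-half (`stub_digitKronecker`, `stub_polarisedSOS`, `stub_budget`) and the PROVED composition
  `SOSMagnification_of` are kept verbatim (the registered signature of `stub_digitKronecker` now INLINES
  `digit/fekDigit/kron/feketePoly`, so that the stub lands as a def-free Theorems file);
* the delegated V-half `stub_vnp` (the digit lift is p-definable) is RE-LINED through the tree's PROVED
  Valiant criterion (`isVNPFamily_circuitSum`, `ValiantCriterion.boolSum_witness`), the PROVED Boolean
  mod-`p` calculus (`HasBits.add`, `Cryptography.HasBits.pow`, `CktSizeVia.allMatch/maskedParity`) and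
  Euler's criterion (`legendreSym.eq_pow`): four registered stubs
  `stub_legendreCircuit` (C1: a `B₂`-circuit deciding `m^{(p-1)/2} = ±1` from the one-hot digits of `m`,
  `p` hard-wired), `stub_oneHotLtCircuit` (C2: a `B₂`-circuit deciding "the input is a one-hot digit
  vector of some `m < p`"), `stub_circuitSumIdentity` (C3: the signed, projected circuit-sum of any Boolean
  function with that specification IS the digit lift — pure reindexing), `stub_vnpAssembly` (C4, the
  lead's: C1+C2+C3 ⇒ `Stmt.stub_vnp` via `ValiantCriterion.witness`, projection and level-wise
  p-boundedness).  No Gauss sums, no polynomial gadgets.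

## The line (growing radix `k = n + 1`, ONE explicit family)

Family `P n := fekDigit (n+1) (p_n) n ∈ ℂ[y_{j,ℓ} : j < n, ℓ ≤ n]` — the one-hot base-`(n+1)` digit lift of the Fekete
polynomial `F_{p_n}`, `p_n` an odd prime with `(n+1)^n / 2 < p_n ≤ (n+1)^n` (Bertrand; `p_n := 3` for `n < 2`).
Assume `FeketeSOSHard` (δ, p₀) and, for contradiction, `VP_ℂ = VNP_ℂ`.
1. `Stmt.stub_vnp` (from C1–C4): `(P n) ∈ VNP_ℂ`.  Hence `(P n) ∈ VP_ℂ`: `complexity (P n) ≤ n^c + c`.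
2. Tree (PROVED): `exists_bilin_of_two_le_totalDegree` — the VSBR middle cut `P n = Σ_{ℓ<t} g_ℓ h_ℓ`,
   `deg g_ℓ ≤ n/2`, `deg h_ℓ ≤ n − n/2`, `t ≤ T(n, complexity) = (n+1)(16 L² (n+1)⁴)^{⌊log₂ n⌋}`.
3. `stub_polarisedSOS` (THE LEVER): set-multilinear projection + polarisation gives a weighted SOS with
   `s ≤ 2^{n+1} t` squares, each with `≤ k^{n/2} + k^{n−n/2}` monomials, all block-sub-multilinear.
4. `stub_digitKronecker`: the inverse Kronecker substitution `κ : y_{j,ℓ} ↦ X^{ℓ k^j}` does not increase supports,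
   gives `natDegree ≤ k^n − 1 ≤ p²`, and `κ (P n) = F_{p_n}`.
5. `stub_budget` (a),(b): the representation is admitted by X and its support-sum is `< p^{1/2+δ}` — contradiction.

Disproof.lean (cdisprove v1.2) used: `not_sosMagnification_iff` (immunity: a proof line); finding 5c;
landed `Negative/FeketeHardDeltaRange` not needed (budget holds for every δ > 0); no `_false_without_` theorem exists.

Layout: `Stmt.*` = precise `Prop`s; `stub_*` = the registered stubs (`sorry`); `vnp_of_stubs : Stmt.stub_vnp`;
`SOSMagnification_of : Stmt.stub_vnp → Stmt.stub_digitKronecker → Stmt.stub_polarisedSOS → Stmt.stub_budget →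
SOSMagnification` PROVED; `SOSMagnification_proof := SOSMagnification_of vnp_of_stubs …`.
-/

set_option linter.dupNamespace false

noncomputable section

open MvPolynomial Finset
open Literature.Computability.AlgebraicComplexity
open Literature.Computability.Complexity (CktSize B2)

namespace Summit.ValiantsHypothesis.ValiantsHypothesis.Cruxes.SOSMagnification.SmlPolarisedTransport

/-! ## Objects (verbatim the definitions of `SketchIdeator3`) -/

/-- the `j`-th base-`k` digit of `m`, as an element of `Fin k` -/
def digit (k : ℕ) [NeZero k] (m j : ℕ) : Fin k :=
  ⟨(m / k ^ j) % k, Nat.mod_lt _ (Nat.pos_of_neZero k)⟩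

/-- DST's one-hot base-`k` digit lift of the Fekete polynomial (DuttaSaxenaThierauf2024 §3.1, `φ^{lin}_{k,n}(F_p)`):
`Fek_{k,p,n}(y) = Σ_{m<p} (m|p) · Π_{j<n} y_{j, digit_j(m)}` in the `n·k` variables `y_{j,ℓ}`. -/
def fekDigit (k : ℕ) [NeZero k] (p : ℕ) [Fact p.Prime] (n : ℕ) : MvPolynomial (Fin n × Fin k) ℂ :=
  ∑ m ∈ range p, C ((legendreSym p m : ℤ) : ℂ) * ∏ j : Fin n, X (j, digit k m j)

/-- the inverse multilinear Kronecker substitution `ψ^{lin}_{k,n} : y_{j,ℓ} ↦ X^{ℓ k^j}` (DST24 eq. (8)) -/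
def kron (k n : ℕ) : Fin n × Fin k → Polynomial ℂ :=
  fun v => (Polynomial.X : Polynomial ℂ) ^ ((v.2 : ℕ) * k ^ (v.1 : ℕ))

/-- the Fekete polynomial exactly as inlined in the route items -/
def feketePoly (p : ℕ) [Fact p.Prime] : Polynomial ℂ :=
  ∑ m ∈ Finset.range p, Polynomial.C ((legendreSym p m : ℤ) : ℂ) * Polynomial.X ^ m

/-! ## Stub statements: the precise `Prop`s -/

/-- **V (VNP half).** For every odd prime selector with `p_n ≤ (n+1)^n` (`n ≥ 2`), the radix-`(n+1)` digit lift
`(Fek_{n+1,p_n,n})_n` is p-definable over `ℂ` (Bürgisser Def. 2.5 = tree `IsVNPFamily`).  Derived below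
(`vnp_of_stubs`) from C1–C4. -/
def Stmt.stub_vnp : Prop :=
  ∀ (pSel : ℕ → ℕ) [∀ n, Fact (pSel n).Prime], (∀ n, pSel n ≠ 2) → (∀ n, 2 ≤ n → pSel n ≤ (n + 1) ^ n) →
    @IsVNPFamily ℂ _ (fun n => Fin n × Fin (n + 1)) _ (fun n => fekDigit (n + 1) (pSel n) n)

/-- **C1 — Legendre test circuit (Euler's criterion on the bus).** Uniformly in `k, n, ℓ` and primes `p ≤ 2^ℓ`
there is a two-output `B₂`-circuit of size `poly(n, k, ℓ)` on the one-hot wires `x_{j,i}` which, fed the one-hot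
encoding of a digit vector `d`, outputs at `b` the bit `[m(d)^{(p-1)/2} = (b ? −1 : 1) in ℤ/p]`, `m(d) = Σ_j d_j k^j`.
Why true: the `ℓ` bits of the residue `d_j·k^j mod p` are each a masked parity (`CktSizeVia.maskedParity`) of the
`k` wires of block `j` (one-hot ⇒ parity = selection), so `HasBits ℓ enc (d ↦ d_j k^j)`; `HasBits.add` (n−1 times),
`Cryptography.HasBits.pow` (exponent `p/2 < 2^ℓ`), then `CktSizeVia.allMatch` against the bits of `1`, resp. `p−1`
(`allMatch_finRange_eq_decide`, `testBits` injective below `2^ℓ`), bundled with `CktSizeVia.pi_const`/`pair` and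
unpacked with `CktSizeVia` = `∃ F, CktSize … ∧ spec`.  [size M–L] -/
def Stmt.legendreCircuit : Prop :=
  ∃ c : ℕ, ∀ (k n ℓ p : ℕ) [Fact p.Prime], 2 ≤ k → 1 ≤ n → p ≤ 2 ^ ℓ →
    ∃ F : ((Fin n × Fin k) → Bool) → Bool → Bool,
      CktSize B2 F (c * ((n + 1) * (k + 1) * (ℓ + 1)) ^ c) ∧
      ∀ (d : Fin n → Fin k) (b : Bool),
        F (fun v => decide (d v.1 = v.2)) b =
          decide ((((∑ j : Fin n, (d j : ℕ) * k ^ (j : ℕ) : ℕ) : ZMod p) ^ (p / 2)) =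
            if b then (-1 : ZMod p) else 1)

/-- **C2 — one-hot validity and comparison circuit.** Uniformly in `k ≥ 2, n ≥ 1` and `p < k^n` there is a
single-output `B₂`-circuit of size `poly(n, k)` on the wires `x_{j,i}` which accepts `x` iff `x` is the one-hot
encoding of a digit vector `d` with `m(d) = Σ_j d_j k^j < p`.
Why true: `G(x) = [∀ j, exactly one i with x_{j,i}] ∧ LEX(x)`, `LEX(x) = ∨_j ([∨_{i < p_j} x_{j,i}] ∧ ∧_{j' > j} x_{j',p_{j'}})`
with `p_j` the base-`k` digits of `p` (valid since `p < k^n`); on one-hot inputs `LEX = [m(d) < p]` is lexicographic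
comparison from the top digit (induction on `n`, `m(d) = m(d|_{<n-1}) + d_{n-1} k^{n-1}`, `m(d|_{<n-1}) < k^{n-1}`);
exactly-one and the OR/AND chains are `O(k)` resp. `O(n)` gates each (`CktSize.comp/pair`, `cktSize_and/or/not`,
`CktSizeVia.binop`, or pairwise NANDs + `allMatch`, `O(nk²)`).  [size M–L] -/
def Stmt.oneHotLtCircuit : Prop :=
  ∃ c : ℕ, ∀ (k n p : ℕ), 2 ≤ k → 1 ≤ n → p < k ^ n →
    ∃ G : ((Fin n × Fin k) → Bool) → Unit → Bool,
      CktSize B2 G (c * ((n + 1) * (k + 1)) ^ c) ∧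
      (∀ x, G x () = true → ∃ d : Fin n → Fin k, x = fun v => decide (d v.1 = v.2)) ∧
      ∀ d : Fin n → Fin k, G (fun v => decide (d v.1 = v.2)) () =
        decide (∑ j : Fin n, (d j : ℕ) * k ^ (j : ℕ) < p)

/-- **C3 — the signed projected circuit-sum is the digit lift (pure reindexing).** For `p ≤ k^n` and ANY Boolean
function `Φ(x, b)` which accepts only one-hot `x`, and accepts `(enc d, b)` iff `m(d) < p` and
`(m(d)|p) = (b ? −1 : 1)`: `Σ_x Σ_b [Φ x b] · (Π_{v : x v} X_v) · (b ? −1 : 1) = Fek_{k,p,n}` (right-hand side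
= `fekDigit k p n` unfolded).  Why true: only `x = enc d` contribute; `Π_{v : enc d v} X_v = Π_j X_{(j, d_j)}`;
the inner `b`-sum is `(m(d)|p) ∈ {0, ±1}`; reindex `d ↔ m = m(d) < k^n` by `finFunctionFinEquiv`
(`finFunctionFinEquiv_apply`, `finFunctionFinEquiv_symm_apply_val` = `digit`) and drop `m ≥ p`.  [size M–L] -/
def Stmt.circuitSumIdentity : Prop :=
  ∀ (k : ℕ) [NeZero k] (n p : ℕ) [Fact p.Prime], p ≤ k ^ n →
    ∀ Φ : ((Fin n × Fin k) → Bool) → Bool → Bool,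
      (∀ x b, Φ x b = true → ∃ d : Fin n → Fin k, x = fun v => decide (d v.1 = v.2)) →
      (∀ (d : Fin n → Fin k) (b : Bool), Φ (fun v => decide (d v.1 = v.2)) b = true ↔
          (∑ j : Fin n, (d j : ℕ) * k ^ (j : ℕ) < p ∧
            legendreSym p (∑ j : Fin n, (d j : ℕ) * k ^ (j : ℕ) : ℕ) = if b then -1 else 1)) →
      (∑ x : (Fin n × Fin k) → Bool, ∑ b : Bool,
          (if Φ x b then (1 : MvPolynomial (Fin n × Fin k) ℂ) else 0) *
            ((∏ v : Fin n × Fin k, if x v then (X v : MvPolynomial (Fin n × Fin k) ℂ) else 1) *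
              (if b then (-1 : MvPolynomial (Fin n × Fin k) ℂ) else 1))) =
        ∑ m ∈ Finset.range p, C ((legendreSym p m : ℤ) : ℂ) *
          ∏ j : Fin n, X (j, (⟨m / k ^ (j : ℕ) % k, Nat.mod_lt _ (Nat.pos_of_neZero k)⟩ : Fin k))

/-- **Stub 2 (digit lift ⟷ Kronecker substitution, size M).** (a) For every `q` whose monomials take at most one
variable (to the first power) from each digit block, `κ = aeval (kron k n)` does not increase the number of monomials
and `natDegree (κ q) ≤ Σ_j (k−1)k^j = k^n − 1` (DST24 Remark 2 after Thm 3.2); (b) for `p ≤ k^n` the digit lift is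
set-multilinear over all blocks, has total degree exactly `n` (the monomial of `m = 1` has coefficient `(1|p) = 1`;
digits below `k^n` are unique), and `κ` inverts the lift: `κ (Fek_{k,p,n}) = F_p` (DST24 eq. (7)–(8),
`Σ_{j<n} digit_j(m) k^j = m` for `m < k^n`).  Leans on: `card_support_aeval_le_of_isTerm`, `isTerm_X_pow`
(RealTauConjectureDepthFour), `Polynomial.natDegree_sum_le_of_forall_le`, `MvPolynomial.aeval_monomial`,
`IsWeightedHomogeneous.sum/mul`, `isSetMultilinear_X`, `finFunctionFinEquiv`, `Nat.mod_pow_succ`, `legendreSym.at_one`. -/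
def Stmt.stub_digitKronecker : Prop :=
  (∀ (n k : ℕ) (q : MvPolynomial (Fin n × Fin k) ℂ),
    (∀ m ∈ q.support, ∀ j : Fin n, ∑ l : Fin k, m (j, l) ≤ 1) →
    (MvPolynomial.aeval (kron k n) q).support.card ≤ q.support.card ∧
    (MvPolynomial.aeval (kron k n) q).natDegree ≤ k ^ n - 1) ∧
  (∀ (k : ℕ) [NeZero k] (p : ℕ) [Fact p.Prime] (n : ℕ), p ≤ k ^ n →
    IsSetMultilinear (Prod.fst : Fin n × Fin k → Fin n) Finset.univ (fekDigit k p n) ∧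
    (fekDigit k p n).totalDegree = n ∧
    MvPolynomial.aeval (kron k n) (fekDigit k p n) = feketePoly p)

/-- **Stub 3 (THE LEVER: set-multilinear projection + polarisation, size M).** If `P` is set-multilinear over all
`n` blocks (block map `Prod.fst`) and `P = Σ_{ℓ<t} g_ℓ h_ℓ` with `deg g_ℓ ≤ D₁`, `deg h_ℓ ≤ D₂`, `k ≥ 1`, then
`P = Σ_{i<s} a_i q_i²` with `s ≤ 2^{n+1} t`, every `q_i` having `≤ k^{D₁} + k^{D₂}` monomials, all of them
block-sub-multilinear.  Proof sketch: `P = smlProj univ P` (`IsSetMultilinear.smlProj_eq`), `smlProj univ (g h) =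
Σ_{S} smlProj S g · smlProj (univ \ S) h` (`smlProj_mul`, PROVED), `4ab = (a+b)² − (a−b)²` over `ℂ`; squares
`q = π_S g ± π_{univ∖S} h` indexed by `Fin t × (univ : Finset (Fin n)).powerset × Fin 2`; `|supp π_S g| ≤ k^{|S|}` (an
`S`-set-multilinear monomial is `Σ_{j∈S} single (j, ℓ_j) 1`, an injection into `S → Fin k`) and `π_S g = 0` unless
`|S| ≤ deg g ≤ D₁` (such a monomial has degree `|S|`), so `|supp q| ≤ k^{D₁} + k^{D₂}`.  Leans on: `smlProj`,
`smlProj_mul`, `coeff_smlProj`, `IsSetMultilinear.smlProj_eq`, `isSetMultilinear_smlProj`, `weight_blockWeight_eq_mapDomain`,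
`MvPolynomial.support_add`, `Finset.card_le_card_of_injOn`, `Fintype.card_pi`, `Fintype.sum_equiv` / `finProdFinEquiv`. -/
def Stmt.stub_polarisedSOS : Prop :=
  ∀ (n k t D₁ D₂ : ℕ) (P : MvPolynomial (Fin n × Fin k) ℂ) (g h : Fin t → MvPolynomial (Fin n × Fin k) ℂ),
    1 ≤ k → IsSetMultilinear (Prod.fst : Fin n × Fin k → Fin n) Finset.univ P →
    P = ∑ l, g l * h l → (∀ l, (g l).totalDegree ≤ D₁) → (∀ l, (h l).totalDegree ≤ D₂) →
    ∃ (s : ℕ) (a : Fin s → ℂ) (q : Fin s → MvPolynomial (Fin n × Fin k) ℂ),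
      s ≤ 2 ^ (n + 1) * t ∧
      P = ∑ i, C (a i) * q i ^ 2 ∧
      (∀ i, (q i).support.card ≤ k ^ D₁ + k ^ D₂) ∧
      (∀ i, ∀ m ∈ (q i).support, ∀ j : Fin n, ∑ l : Fin k, m (j, l) ≤ 1)

/-- **Stub 4 (the budget: eventual inequalities with radix `n+1`, size M).** For every `c` and `δ > 0` there is
`n₀` such that for `n ≥ n₀`, `L ≤ n^c + c` and every `p` with `(n+1)^n < 2p ≤ 2(n+1)^n`, writing
`T := (n+1)·(16 L² (n+1)⁴)^{⌊log₂ n⌋}`: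
`n ≤ p`, `(n+1)^n − 1 ≤ p²`, (a) `2^{n+1} T ≤ p^δ`, (b) `2^{n+1} T ((n+1)^{⌊n/2⌋} + (n+1)^{n−⌊n/2⌋}) < p^{1/2+δ}`.
Why true: `log₂ T = O_c(log² n)` while `δ log₂ p ≥ δ (n log₂(n+1) − 1)`.  TRUE FOR EVERY δ > 0.  Suggested formal
route (only monotonicity of `t ↦ t^δ` and `(x^a)^b = x^{ab}` from ℝ): take `n₀` with `16 ≤ (n₀+1)^δ`
(`tendsto_rpow_atTop` or `⌈16^{1/δ}⌉₊`); from `p > (n+1)^n/2 ≥ (n+1)^{n−1}` get `p^δ ≥ ((n+1)^{n−1})^δ = ((n+1)^δ)^{n−1} ≥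
16^{n−1}` (`Real.rpow_natCast_mul`, `Real.rpow_le_rpow`), so (a) follows from the ℕ-inequality `2^{n+1} T ≤ 16^{n−1}`; for
(b) compare squares: `(p^{1/2+δ})² = p·(p^δ)² ≥ p·16^{2n−2}`, `2p > (n+1)^n`, `((n+1)^{⌊n/2⌋} + (n+1)^{n−⌊n/2⌋})² ≤ 4(n+1)^{n+1}`,
reducing (b) to `2^{2n+5} T² (n+1) ≤ 16^{2n−2}`; both ℕ-inequalities hold for large `n` because
`T ≤ (n+1)^{(2c+11)(⌊log₂ n⌋+1)} ≤ 2^{(2c+11)(⌊log₂ n⌋+1)²}` (`Nat.lt_pow_succ_log_self`, `Nat.pow_le_pow_left`) and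
`2(2c+11)(m+1)² + m + 14 ≤ 6·2^m ≤ 6n` for `m = ⌊log₂ n⌋` large.  Onsets (planner numerics): `n₀ ≈ 134/168/204`
(c = 1/2/3, δ = 1/2), `4442/5296/6118` (δ = 1/10). -/
def Stmt.stub_budget : Prop :=
  ∀ (c : ℕ) (δ : ℝ), 0 < δ → ∃ n₀ : ℕ, ∀ n : ℕ, n₀ ≤ n → ∀ L : ℕ, L ≤ n ^ c + c →
    ∀ p : ℕ, (n + 1) ^ n < 2 * p → p ≤ (n + 1) ^ n →
      n ≤ p ∧ (n + 1) ^ n - 1 ≤ p ^ 2 ∧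
      ((2 ^ (n + 1) * ((n + 1) * ((4 * L * (n + 1) ^ 2) * (4 * L * (n + 1) ^ 2)) ^ Nat.log 2 n) : ℕ) : ℝ)
          ≤ (p : ℝ) ^ δ ∧
      ((2 ^ (n + 1) * ((n + 1) * ((4 * L * (n + 1) ^ 2) * (4 * L * (n + 1) ^ 2)) ^ Nat.log 2 n) *
          ((n + 1) ^ (n / 2) + (n + 1) ^ (n - n / 2)) : ℕ) : ℝ) < (p : ℝ) ^ (1 / 2 + δ)

/-! ## Registered stubs (the ONLY sorries of this file) -/

/-- stub C1 = `Stmt.legendreCircuit` (Legendre test circuit on one-hot digit wires; Euler's criterion). -/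
theorem stub_legendreCircuit :
    ∃ c : ℕ, ∀ (k n ℓ p : ℕ) [Fact p.Prime], 2 ≤ k → 1 ≤ n → p ≤ 2 ^ ℓ →
      ∃ F : ((Fin n × Fin k) → Bool) → Bool → Bool,
        CktSize B2 F (c * ((n + 1) * (k + 1) * (ℓ + 1)) ^ c) ∧
        ∀ (d : Fin n → Fin k) (b : Bool),
          F (fun v => decide (d v.1 = v.2)) b =
            decide ((((∑ j : Fin n, (d j : ℕ) * k ^ (j : ℕ) : ℕ) : ZMod p) ^ (p / 2)) =
              if b then (-1 : ZMod p) else 1) := by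
  sorry

/-- stub C2 = `Stmt.oneHotLtCircuit` (one-hot validity and `m < p` comparison circuit). -/
theorem stub_oneHotLtCircuit :
    ∃ c : ℕ, ∀ (k n p : ℕ), 2 ≤ k → 1 ≤ n → p < k ^ n →
      ∃ G : ((Fin n × Fin k) → Bool) → Unit → Bool,
        CktSize B2 G (c * ((n + 1) * (k + 1)) ^ c) ∧
        (∀ x, G x () = true → ∃ d : Fin n → Fin k, x = fun v => decide (d v.1 = v.2)) ∧
        ∀ d : Fin n → Fin k, G (fun v => decide (d v.1 = v.2)) () =
          decide (∑ j : Fin n, (d j : ℕ) * k ^ (j : ℕ) < p) := by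
  sorry

/-- stub C3 = `Stmt.circuitSumIdentity` (the signed projected circuit-sum is the digit lift). -/
theorem stub_circuitSumIdentity :
    ∀ (k : ℕ) [NeZero k] (n p : ℕ) [Fact p.Prime], p ≤ k ^ n →
      ∀ Φ : ((Fin n × Fin k) → Bool) → Bool → Bool,
        (∀ x b, Φ x b = true → ∃ d : Fin n → Fin k, x = fun v => decide (d v.1 = v.2)) →
        (∀ (d : Fin n → Fin k) (b : Bool), Φ (fun v => decide (d v.1 = v.2)) b = true ↔
            (∑ j : Fin n, (d j : ℕ) * k ^ (j : ℕ) < p ∧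
              legendreSym p (∑ j : Fin n, (d j : ℕ) * k ^ (j : ℕ) : ℕ) = if b then -1 else 1)) →
        (∑ x : (Fin n × Fin k) → Bool, ∑ b : Bool,
            (if Φ x b then (1 : MvPolynomial (Fin n × Fin k) ℂ) else 0) *
              ((∏ v : Fin n × Fin k, if x v then (X v : MvPolynomial (Fin n × Fin k) ℂ) else 1) *
                (if b then (-1 : MvPolynomial (Fin n × Fin k) ℂ) else 1))) =
          ∑ m ∈ Finset.range p, C ((legendreSym p m : ℤ) : ℂ) *
            ∏ j : Fin n, X (j, (⟨m / k ^ (j : ℕ) % k, Nat.mod_lt _ (Nat.pos_of_neZero k)⟩ : Fin k)) := by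
  sorry

/-- stub C4 = the V-half assembly (LEAD's stub): C1 + C2 + C3 ⇒ `Stmt.stub_vnp`.  Route: per level `n ≥ 2`
(`k = n+1`, `p = p_n < k^n` since `(n+1)^n` is not prime, `ℓ = n·n`, `p ≤ (n+1)^n ≤ 2^{n²}`): combine the circuits of
C1/C2 with one sign wire into `H(x, σ) = G(x) ∧ F(x, σ)` (`CktSize.rewire/pair/comp`, `cktSize_univ` on 4 wires),
transport to `Fin (n(n+1)+1)` (`rewire` along `finSumFinEquiv ∘ sumCongr finProdFinEquiv _`), `CktSize.toCircuit`,
take `g n :=` the projection `X_t ↦ X_{(j,i)}`, `X_σ ↦ −1` of `ValiantCriterion.witness Q` (`boolSum_witness`,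
`complexity_witness_le`, `totalDegree_witness_le`, `IsProjection.complexity_le_holds`/`totalDegree_le_holds`), identify
`boolSum (g n) = fekDigit` by C3 (Euler: `legendreSym.eq_pow`, `ZMod.neg_one_ne_one`), and at `n < 2` the empty
Boolean sum of the member itself (`complexity (fekDigit k p n) ≤ p(n+2)`); p-boundedness level-wise as in
`IsPBounded.iff_exists_le_mul_succ_pow`. -/
theorem stub_vnpAssembly :
    Stmt.legendreCircuit → Stmt.oneHotLtCircuit → Stmt.circuitSumIdentity → Stmt.stub_vnp := by
  sorry

/-- stub 2 = `Stmt.stub_digitKronecker` with `digit/fekDigit/kron/feketePoly` INLINED (so the stub lands def-free). -/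
theorem stub_digitKronecker :
    (∀ (n k : ℕ) (q : MvPolynomial (Fin n × Fin k) ℂ),
      (∀ m ∈ q.support, ∀ j : Fin n, ∑ l : Fin k, m (j, l) ≤ 1) →
      (MvPolynomial.aeval (fun v : Fin n × Fin k => (Polynomial.X : Polynomial ℂ) ^ ((v.2 : ℕ) * k ^ (v.1 : ℕ))) q).support.card
          ≤ q.support.card ∧
      (MvPolynomial.aeval (fun v : Fin n × Fin k => (Polynomial.X : Polynomial ℂ) ^ ((v.2 : ℕ) * k ^ (v.1 : ℕ))) q).natDegree
          ≤ k ^ n - 1) ∧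
    (∀ (k : ℕ) [NeZero k] (p : ℕ) [Fact p.Prime] (n : ℕ), p ≤ k ^ n →
      IsSetMultilinear (Prod.fst : Fin n × Fin k → Fin n) Finset.univ
        (∑ m ∈ Finset.range p, C ((legendreSym p m : ℤ) : ℂ) *
          ∏ j : Fin n, X (j, (⟨m / k ^ (j : ℕ) % k, Nat.mod_lt _ (Nat.pos_of_neZero k)⟩ : Fin k)) :
            MvPolynomial (Fin n × Fin k) ℂ) ∧
      (∑ m ∈ Finset.range p, C ((legendreSym p m : ℤ) : ℂ) *
          ∏ j : Fin n, X (j, (⟨m / k ^ (j : ℕ) % k, Nat.mod_lt _ (Nat.pos_of_neZero k)⟩ : Fin k)) :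
            MvPolynomial (Fin n × Fin k) ℂ).totalDegree = n ∧
      MvPolynomial.aeval (fun v : Fin n × Fin k => (Polynomial.X : Polynomial ℂ) ^ ((v.2 : ℕ) * k ^ (v.1 : ℕ)))
          (∑ m ∈ Finset.range p, C ((legendreSym p m : ℤ) : ℂ) *
            ∏ j : Fin n, X (j, (⟨m / k ^ (j : ℕ) % k, Nat.mod_lt _ (Nat.pos_of_neZero k)⟩ : Fin k)) :
              MvPolynomial (Fin n × Fin k) ℂ) =
        ∑ m ∈ Finset.range p, Polynomial.C ((legendreSym p m : ℤ) : ℂ) * Polynomial.X ^ m) := by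
  sorry

/-- stub 3 = `Stmt.stub_polarisedSOS` (the lever; hardest stub native to this line). -/
theorem stub_polarisedSOS :
    ∀ (n k t D₁ D₂ : ℕ) (P : MvPolynomial (Fin n × Fin k) ℂ) (g h : Fin t → MvPolynomial (Fin n × Fin k) ℂ),
      1 ≤ k → IsSetMultilinear (Prod.fst : Fin n × Fin k → Fin n) Finset.univ P →
      P = ∑ l, g l * h l → (∀ l, (g l).totalDegree ≤ D₁) → (∀ l, (h l).totalDegree ≤ D₂) →
      ∃ (s : ℕ) (a : Fin s → ℂ) (q : Fin s → MvPolynomial (Fin n × Fin k) ℂ),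
        s ≤ 2 ^ (n + 1) * t ∧
        P = ∑ i, C (a i) * q i ^ 2 ∧
        (∀ i, (q i).support.card ≤ k ^ D₁ + k ^ D₂) ∧
        (∀ i, ∀ m ∈ (q i).support, ∀ j : Fin n, ∑ l : Fin k, m (j, l) ≤ 1) := by
  sorry

/-- stub 4 = `Stmt.stub_budget` (eventual inequalities, radix n+1). -/
theorem stub_budget :
    ∀ (c : ℕ) (δ : ℝ), 0 < δ → ∃ n₀ : ℕ, ∀ n : ℕ, n₀ ≤ n → ∀ L : ℕ, L ≤ n ^ c + c →
      ∀ p : ℕ, (n + 1) ^ n < 2 * p → p ≤ (n + 1) ^ n →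
        n ≤ p ∧ (n + 1) ^ n - 1 ≤ p ^ 2 ∧
        ((2 ^ (n + 1) * ((n + 1) * ((4 * L * (n + 1) ^ 2) * (4 * L * (n + 1) ^ 2)) ^ Nat.log 2 n) : ℕ) : ℝ)
            ≤ (p : ℝ) ^ δ ∧
        ((2 ^ (n + 1) * ((n + 1) * ((4 * L * (n + 1) ^ 2) * (4 * L * (n + 1) ^ 2)) ^ Nat.log 2 n) *
            ((n + 1) ^ (n / 2) + (n + 1) ^ (n - n / 2)) : ℕ) : ℝ) < (p : ℝ) ^ (1 / 2 + δ) := by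
  sorry

/-! ## Derived statements (PROVED): the registered stubs give the `Stmt.*` hypotheses of the composition -/

/-- C1–C4 ⇒ the VNP half. -/
theorem vnp_of_stubs : Stmt.stub_vnp :=
  stub_vnpAssembly stub_legendreCircuit stub_oneHotLtCircuit stub_circuitSumIdentity

/-- the inlined stub 2 is `Stmt.stub_digitKronecker` (definitional unfolding of `digit/fekDigit/kron/feketePoly`). -/
theorem digitKronecker_of_stub : Stmt.stub_digitKronecker := stub_digitKronecker

/-! ## Composition (PROVED): the four stubs imply the crux BY NAME -/

/-- **The line.** `Stmt.stub_vnp → Stmt.stub_digitKronecker → Stmt.stub_polarisedSOS → Stmt.stub_budget →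
SOSMagnification`:
DST's magnification for the Fekete family with radix `n+1`, the entropy-free count of the projected cut, and the
VSBR middle cut from the tree (`exists_bilin_of_two_le_totalDegree`).  Sorry-free. -/
theorem SOSMagnification_of (hVNP : Stmt.stub_vnp) (hDK : Stmt.stub_digitKronecker)
    (hPol : Stmt.stub_polarisedSOS) (hBud : Stmt.stub_budget) :
    Summit.ValiantsHypothesis.ValiantsHypothesis.Theses.FeketeSOS.SOSMagnification := by
  intro hHard
  show Literature.Computability.AlgebraicComplexity.VP ℂ ≠ Literature.Computability.AlgebraicComplexity.VNP ℂ
  intro hEq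
  obtain ⟨hKron, hFam⟩ := hDK
  -- (1) an odd prime selector with (n+1)^n / 2 < p_n ≤ (n+1)^n for n ≥ 2 (Bertrand), p_n := 3 below 2
  have hsel : ∀ n : ℕ, ∃ p : ℕ, p.Prime ∧ p ≠ 2 ∧ (2 ≤ n → p ≤ (n + 1) ^ n) ∧
      (2 ≤ n → (n + 1) ^ n < 2 * p) := by
    intro n
    by_cases hn : 2 ≤ n
    · have h9 : 9 ≤ (n + 1) ^ n :=
        calc 9 = 3 ^ 2 := by norm_num
          _ ≤ (n + 1) ^ 2 := Nat.pow_le_pow_left (by omega) 2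
          _ ≤ (n + 1) ^ n := Nat.pow_le_pow_right (by omega) hn
      generalize hX : (n + 1) ^ n = X at h9 ⊢
      obtain ⟨p, hp, hlt, hle⟩ := Nat.exists_prime_lt_and_le_two_mul (X / 2) (by omega)
      exact ⟨p, hp, by omega, fun _ => by omega, fun _ => by omega⟩
    · exact ⟨3, Nat.prime_three, by norm_num, fun h => absurd h hn, fun h => absurd h hn⟩
  choose pSel hpP hp2 hple hpbig using hsel
  haveI hFact : ∀ n, Fact (pSel n).Prime := fun n => ⟨hpP n⟩
  -- (2) VNP-membership (stub 1) and VP = VNP ⇒ the family is in VP ⇒ a complexity exponent c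
  have h1 : IsVNPFamily (k := ℂ) (σ := fun n => Fin n × Fin (n + 1))
      (fun n => fekDigit (n + 1) (pSel n) n) := hVNP pSel hp2 hple
  have hVP : IsVPFamily (k := ℂ) (σ := fun n => Fin n × Fin (n + 1))
      (fun n => fekDigit (n + 1) (pSel n) n) := by
    have hmem : PolyFamily.ofFintype (fun n => fekDigit (n + 1) (pSel n) n) ∈
        Literature.Computability.AlgebraicComplexity.VNP ℂ :=
      (mem_VNP_ofFintype_iff_holds (k := ℂ) (σ := fun n => Fin n × Fin (n + 1))
        (fun n => fekDigit (n + 1) (pSel n) n)).2 h1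
    rw [← hEq] at hmem
    exact (mem_VP_ofFintype_iff_holds (k := ℂ) (σ := fun n => Fin n × Fin (n + 1))
      (fun n => fekDigit (n + 1) (pSel n) n)).1 hmem
  obtain ⟨c, hc⟩ := hVP.2
  -- (3) hardness data (δ, p₀) and the budget (stub 4) at a large n
  obtain ⟨δ, hδ, p₀, H⟩ := hHard
  obtain ⟨n₀, hn₀⟩ := hBud c δ hδ
  obtain ⟨n, hn₀n, hp₀n, h2n⟩ : ∃ n, n₀ ≤ n ∧ p₀ ≤ n ∧ 2 ≤ n :=
    ⟨max (max n₀ p₀) 2, le_trans (le_max_left _ _) (le_max_left _ _),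
      le_trans (le_max_right _ _) (le_max_left _ _), le_max_right _ _⟩
  have hpk : pSel n ≤ (n + 1) ^ n := hple n h2n
  have hkp : (n + 1) ^ n < 2 * pSel n := hpbig n h2n
  obtain ⟨hnp, hdegcap, hA, hB⟩ :=
    hn₀ n hn₀n (complexity (fekDigit (n + 1) (pSel n) n)) (hc n) (pSel n) hkp hpk
  -- (4) digit-lift facts (stub 2b)
  obtain ⟨hsml, hdeg, hfaith⟩ := hFam (n + 1) (pSel n) n hpk
  -- (5) the bilinear middle cut of the digit family at j = n/2 (tree: DST24 Lemma 3.1, steps 1–4; PROVED)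
  have h2deg : 2 ≤ (fekDigit (n + 1) (pSel n) n).totalDegree := by rw [hdeg]; exact h2n
  obtain ⟨-, Lst, hLlen, hLdeg, hLsum⟩ :=
    exists_bilin_of_two_le_totalDegree (fekDigit (n + 1) (pSel n) n) h2deg (n / 2)
  rw [hdeg] at hLlen hLdeg
  set t := Lst.length with ht
  have hPsum : fekDigit (n + 1) (pSel n) n = ∑ i : Fin t, (Lst[(i : ℕ)]).1 * (Lst[(i : ℕ)]).2 := by
    rw [Fin.sum_univ_fun_getElem Lst fun gh => gh.1 * gh.2]
    exact hLsum.symm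
  have hgdeg : ∀ i : Fin t, (Lst[(i : ℕ)]).1.totalDegree ≤ n / 2 := fun i =>
    (hLdeg _ (List.getElem_mem i.2)).1
  have hhdeg : ∀ i : Fin t, (Lst[(i : ℕ)]).2.totalDegree ≤ n - n / 2 := fun i =>
    (hLdeg _ (List.getElem_mem i.2)).2
  -- (6) set-multilinear projection + polarisation (stub 3: the lever)
  obtain ⟨s, a, q, hs, hrep, hsupp, hbsm⟩ :=
    hPol n (n + 1) t (n / 2) (n - n / 2) (fekDigit (n + 1) (pSel n) n)
      (fun i => (Lst[(i : ℕ)]).1) (fun i => (Lst[(i : ℕ)]).2) (by omega) hsml hPsum hgdeg hhdeg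
  -- (7) Kronecker transport (stub 2a) of the identity, of supports and of degrees
  have hGrep : (∑ i, Polynomial.C (a i) * (MvPolynomial.aeval (kron (n + 1) n) (q i)) ^ 2) =
      ∑ m ∈ Finset.range (pSel n), Polynomial.C ((legendreSym (pSel n) m : ℤ) : ℂ) * Polynomial.X ^ m := by
    have h := congrArg (MvPolynomial.aeval (kron (n + 1) n)) hrep
    rw [hfaith, map_sum] at h
    simp only [map_mul, map_pow, MvPolynomial.aeval_C, Polynomial.algebraMap_eq] at h
    exact h.symm
  have hGsupp : ∀ i, (MvPolynomial.aeval (kron (n + 1) n) (q i)).support.card ≤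
      (n + 1) ^ (n / 2) + (n + 1) ^ (n - n / 2) := fun i =>
    ((hKron n (n + 1) (q i) (hbsm i)).1).trans (hsupp i)
  have hGdeg : ∀ i, (MvPolynomial.aeval (kron (n + 1) n) (q i)).natDegree ≤ pSel n ^ 2 := fun i =>
    ((hKron n (n + 1) (q i) (hbsm i)).2).trans hdegcap
  -- (8) few squares: s ≤ 2^{n+1} T ≤ p^δ
  have hsT : s ≤ 2 ^ (n + 1) * ((n + 1) * ((4 * complexity (fekDigit (n + 1) (pSel n) n) * (n + 1) ^ 2) *
      (4 * complexity (fekDigit (n + 1) (pSel n) n) * (n + 1) ^ 2)) ^ Nat.log 2 n) :=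
    hs.trans (Nat.mul_le_mul_left _ hLlen)
  have hsR : (s : ℝ) ≤ (pSel n : ℝ) ^ δ := le_trans (by exact_mod_cast hsT) hA
  -- (9) the hardness hypothesis applied at p = p_n ≥ p₀ to the admitted representation
  have key := H (pSel n) (hp₀n.trans hnp) s a (fun i => MvPolynomial.aeval (kron (n + 1) n) (q i))
    hsR hGdeg hGrep
  -- (10) the support-sum count and the contradiction with the budget (b)
  have hsum : (∑ i, ((MvPolynomial.aeval (kron (n + 1) n) (q i)).support.card : ℝ)) ≤
      ((2 ^ (n + 1) * ((n + 1) * ((4 * complexity (fekDigit (n + 1) (pSel n) n) * (n + 1) ^ 2) *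
        (4 * complexity (fekDigit (n + 1) (pSel n) n) * (n + 1) ^ 2)) ^ Nat.log 2 n) *
        ((n + 1) ^ (n / 2) + (n + 1) ^ (n - n / 2)) : ℕ) : ℝ) := by
    calc (∑ i, ((MvPolynomial.aeval (kron (n + 1) n) (q i)).support.card : ℝ))
        ≤ ∑ _i : Fin s, (((n + 1) ^ (n / 2) + (n + 1) ^ (n - n / 2) : ℕ) : ℝ) :=
          Finset.sum_le_sum fun i _ => by exact_mod_cast hGsupp i
      _ = (s : ℝ) * (((n + 1) ^ (n / 2) + (n + 1) ^ (n - n / 2) : ℕ) : ℝ) := by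
          rw [Finset.sum_const, Finset.card_univ, Fintype.card_fin, nsmul_eq_mul]
      _ ≤ _ := by exact_mod_cast Nat.mul_le_mul_right _ hsT
  linarith

/-- **The crux from the registered stubs** (becomes the crux proof when the seven `sorry`s are discharged). -/
theorem SOSMagnification_proof :
    Summit.ValiantsHypothesis.ValiantsHypothesis.Theses.FeketeSOS.SOSMagnification :=
  SOSMagnification_of vnp_of_stubs digitKronecker_of_stub stub_polarisedSOS stub_budget

end Summit.ValiantsHypothesis.ValiantsHypothesis.Cruxes.SOSMagnification.SmlPolarisedTransport

end
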